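import Mathlib
import HarnessLib
import Summits.HubbardSuperconductivity.HubbardSuperconductivity.Theorems.KLProgrammeNonCooperKernelsDefs
import Summits.HubbardSuperconductivity.HubbardSuperconductivity.Theorems.KLProgrammeLocalisedCooperDefs
import Summits.HubbardSuperconductivity.HubbardSuperconductivity.Theorems.KLProgrammeDispersionFlowDefs

/-!
# Route `KLProgramme` — constants, majorants and the two-leg renormalisation predicate (D1″)
# for the glued split of crux K3 `KLRegimeTwoPointLimit` (stmt-HubbardSuperconductivity-19937; cell gate-hubbard-kl,
# DECOMP v7.2 §8 (i) shape ruling S1–S3; seat p2).  Part 1 of 3 (`…SplitConsts` → `…SplitPredicates` → `…SplitDefs`).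

The split of K3 (plan g8, 2026-08-26T04:10:52Z) is into CONDITIONAL STEP statements over per-scale predicates, in the
COUNTERTERM scheme of the cell's model-bound carrier (eng's D1 `KLProgrammeSectorisedLegKernelsDefs`: the scale-`h = -n`
effective action `klEffectiveAction L M β U μ K e₀ n` of the Hubbard torus in a `C₄ᵥ` frame `K : TrigPolyC4v`, renormalised
band `e_K = ε - μ - K`).  This module holds: the fixed conventions (`e₀ = klE0 = 1/32`, the analysis window `[-1, -0.15]`),
the four CONSTANT PACKAGES `G/P/Q/R` with their well-formedness predicates, the DETERMINISTIC MAJORANTS from which the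
Riccati envelopes of (B1) are built, the two-leg localisation D1″ (`klFermiMismatch`, `klLocSelfEnergyRe`, `RenormalisedAt` —
over the tree's `SymmetricRegimeFunctionals.fermiMismatch` / `fieldStrength`, no new operator).  Part 2 adds the
`C₄ᵥ`-symmetrised trigonometric interpolant, the two-leg PIECES, the frame class `FrameOK` and the three other per-scale
predicates.  Definitions only; nothing is asserted about the model.

## Constants: who chooses what (so that the glue composes — `KLProgrammeKLRegimeSplitDefs.lean`)
`G : GeoConsts` (absolute: second-order / geometric sizes; ∃ at the head of child 3, before everything), `P : SplitConsts`
(the flow's induction constants `Klam, C_W, Cd, t₀`; ∃ by child 1 given `G`), `Q : EngConsts` (the engine's higher-order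
constants and volume thresholds; ∃ by child 3 given `P`), `R : RenConsts` (renormalisation / frame constants; ∃ by child 2),
then `c` (KL regime, `U²|h| log 4 ≤ c`) small and `U₀(c)` small.  CONVENTION making the bootstrap close: every engine OUTPUT
bound has the shape `(G-constant + Q-constant·|U|) × (explicit size in U, Klam, 4ⁿ)` — leading parts absolute, dependence on
the induction constants one power of `U` down (BGM Thm 3.1's closure `|λ_h| ≤ |U| + C U²|h| ≤ 2|U|`, here without `|h|`).

## `RenormalisedAt` (p2's predicate of this part)
* `RenormalisedAt … K R n`: the FRAME `K` is renormalised down to scale `n`: Fermi-curve mismatch (max over the shell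
  `|e_K| ≤ Λ_n` of `|Re Σ_n(ω₀, k, σ)|`) `≤ cr·|U|·Λ_n` and field strength within `cz|U|` of `1` on the shell.  HYPOTHESIS-ONLY:
  in the counterterm scheme the relevant two-leg direction is not concluded by any per-scale step — it is fixed globally by
  child 2's choice of `K` (FST's inversion); hence this fourth per-scale predicate (in-cycle refinement of S1's three).
References: BGM 2006 = G. Benfatto, A. Giuliani, V. Mastropietro, Ann. Henri Poincaré 7 (2006) 809 [arXiv:cond-mat/0507686]
§2.3–2.4, (2.36), (2.42), §3 Thm 3.1; FST II = Feldman–Salmhofer–Trubowitz, CPAM 51 (1998) 1133 (geometric constants);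
FST, CPAM 53 (2000) 1350 (inversion); HOME/DECOMP.md v7.2 §2 C4a, §8 (i), App. C–D; HOME/p1/ENGINE-PRED.md §1/§3 (constants,
remainder budget); HOME/prover-p1b/BETASPLIT-PRED.md §1.
-/

noncomputable section

namespace Summit.HubbardSuperconductivity.HubbardSuperconductivity.Theorems.KLRegimeSplit

set_option linter.dupNamespace false -- summit = problem name (single-conjunct summit), D-0017

open scoped InnerProductSpace
open Real Finset Literature.MathematicalPhysics.QuantumLattice Literature.Probability.LatticeModels
open Literature.MathematicalPhysics.QuantumLattice.FermiRG
open Summit.HubbardSuperconductivity.HubbardSuperconductivity.Theorems.KLProgrammeLegKernels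
open Summit.HubbardSuperconductivity.HubbardSuperconductivity.Theorems.CooperChannelRiccatiFlow
open Summit.HubbardSuperconductivity.HubbardSuperconductivity.Theorems.CooperVertexBlocks
open Summit.HubbardSuperconductivity.HubbardSuperconductivity.Theorems.DispersionFlow

/-! ## §0 Fixed conventions -/

/-- **The UV end of the infrared region**, FIXED: `e₀ = 1/32` (BGM 2006 §2.4 item 1: the multiscale analysis runs on the tube
`|e_K| ≤ e₀`; `1/32 < 3/80 = r₀` of `FrameOK`, so every scale sits inside the tube where the frame's geometry is controlled).
All predicates below read D1's objects at `e₀ = klE0`. -/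
def klE0 : ℝ := 1 / 32

/-- The analysis window of K3 in the `μ`-parametrisation (the registered stub `KLRegimeAnalysisWindow` of the birth skeleton is
K3 on exactly this window; S0 `MuOfDopingWindow` places `μ(δ)`, `δ ∈ [0.10, 0.35]`, inside it). -/
def klWindow : Set ℝ := Set.Icc (-1 : ℝ) (-0.15)

/-- `|U|` at zeroth order, `U²` from first order on: the `U`-power of the `j`-th derivative clause of the two-leg increments
(BGM (2.36): `C₀|U|` for the value — the tadpole is first order —, `C_j U²` for `j ≥ 1` — the tadpole is momentum-independent). -/
def uPow (j : ℕ) (U : ℝ) : ℝ := if j = 0 then |U| else U ^ 2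

/-- The freezing sum `F(m) = Σ_{i=1}^{m} (i + 1 + 1/3) 4^{-i}` of (B3)(b) (`≤ 1`; p1b `klss_sum_weighted_geometric_le`). [p3's sketch] -/
def freezeF (m : ℕ) : ℝ := ∑ i ∈ Icc 1 m, ((i : ℝ) + 1 + 1 / 3) * ((4 : ℝ) ^ i)⁻¹

/-! ## §1 The constant packages -/

/-- **`G` — the absolute constants** (fixed by the engine before anything else; they multiply the LEADING, second-order or
geometric, part of every engine output): initial block data `atop χ·|U|`, `abot χ·U²` after the UV step; the bubble-mass window
`[blo, bhi]` per scale (≈ `ln 4` in `cooperMatrix`'s normalisation); the ladder-localisation slack `cloc` with its rate `θ`;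
the Kohn–Luttinger DRIVE shape `a χ·U²·ζ n` (channel-projected negative part of the particle–hole source, concentrated at
`O(1)` scales; its identification with the certified kernel is C3) and the positive drive coefficient `aplus`; the two-shell
bubble GAINS `ppGain n ρ`, `phGain n ρ` at transfer of torus size `ρ` with their freezing constant `CF` (Lemma E.1/E.3);
the leading first-moment constant `cE4`; the leading two-leg sizes `S j`, floor junk `Bf`,
Lipschitz `SL`. -/
structure GeoConsts where
  /-- initial block tops: `blkSup 0 χ ≤ (atop χ + Q-slack·|U|)·|U|` -/
  atop : D4Irrep → ℝ
  /-- initial block bottoms: `blkInf 0 χ ≥ -(abot χ + Q-slack·|U|)·U²` -/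
  abot : D4Irrep → ℝ
  /-- lower end of the one-scale bubble mass -/
  blo : ℝ
  /-- upper end of the one-scale bubble mass -/
  bhi : ℝ
  /-- ladder-localisation slack constant (E.5 (ii)) -/
  cloc : ℝ
  /-- its decay rate: slack `∝ 4^{-θ n}`, `0 < θ ≤ 1/2` -/
  θ : ℝ
  /-- attractive drive coefficients `a χ` (the KL source, `≈` the certified `a_Γ(δ)` up to C3) -/
  a : D4Irrep → ℝ
  /-- scale profile of the drive, summable: `Σ ζ ≤ Z` -/
  ζ : ℕ → ℝ
  /-- total drive mass -/
  Z : ℝ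
  /-- positive (repulsive-side) drive coefficient: `≤ aplus·(Klam U)²·ζ n` -/
  aplus : ℝ
  /-- two-shell particle–particle bubble gain at scale `n`, pp-transfer of torus size `ρ` -/
  ppGain : ℕ → ℝ → ℝ
  /-- two-shell particle–hole bubble gain at scale `n`, ph-transfer of torus size `ρ` -/
  phGain : ℕ → ℝ → ℝ
  /-- freezing constant of the gains (Lemma E.1/E.3) -/
  CF : ℝ
  /-- leading constant of the first moments (E4) -/
  cE4 : ℝ
  /-- leading two-leg increment sizes, `j`-th derivative, `j ≤ 4` (E3) -/
  S : ℕ → ℝ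
  /-- leading tangential-floor junk (E3) -/
  Bf : ℝ
  /-- leading frame-Lipschitz constant (E3) -/
  SL : ℝ

/-- Well-formedness of `G`: signs, `0 < θ ≤ 1/2`, `0 ≤ blo ≤ bhi`, summability of the drive profile, and the FREEZING bounds of
the bubble gains — the content of Lemma E.1/E.3 (p1b's `kltb_*`/`klss_*` chain) in the form child 1 consumes: particle–hole gains
summable uniformly in the transfer (E.2: the ph ladders live at `O(1)` scales), particle–particle gains summable below the
transfer's own scale (`4^{-(t+1)} < ρ`: scales `j > t` are frozen). -/
def GeoConsts.WF (G : GeoConsts) : Prop :=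
    (∀ χ, 0 ≤ G.atop χ) ∧
    (∀ χ, 0 ≤ G.abot χ) ∧
    (0 ≤ G.blo) ∧
    (G.blo ≤ G.bhi) ∧
    (0 ≤ G.cloc) ∧
    (0 < G.θ) ∧
    (G.θ ≤ 1 / 2) ∧
    (∀ χ, 0 ≤ G.a χ) ∧
    (∀ n, 0 ≤ G.ζ n) ∧
    (∀ N, ∑ n ∈ range N, G.ζ n ≤ G.Z) ∧
    (0 ≤ G.aplus) ∧
    (∀ n ρ, 0 ≤ G.ppGain n ρ) ∧
    (∀ n ρ, 0 ≤ G.phGain n ρ) ∧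
    (0 ≤ G.CF) ∧
    (∀ (ρ : ℝ) (N : ℕ), 0 ≤ ρ → ∑ n ∈ range N, G.phGain n ρ ≤ G.CF) ∧
    (∀ (ρ : ℝ) (t N : ℕ), ((4 : ℝ) ^ (t + 1))⁻¹ < ρ → ∑ n ∈ Ioc t N, G.ppGain n ρ ≤ G.CF) ∧
    (0 ≤ G.cE4) ∧
    (∀ j, 0 ≤ G.S j) ∧
    (0 ≤ G.Bf) ∧
    (0 ≤ G.SL)

/-- **`P` — the flow's induction constants** (chosen by child 1 knowing `G`): the (2.71a) constant `Klam` («`C ↦ K`», App. E E0),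
the frozen / non-Cooper constant `C_W` (E2 (a)(d)), the first-moment constant `Cd` ((H_n-∂), E2-NOTE §7), the Cooper-class
resolution offset `t₀`. -/
structure SplitConsts where
  /-- the (2.71a) constant: fixed-tuple `L¹` size of the quartic kernel `≤ Klam·|U|` -/
  Klam : ℝ
  /-- frozen / non-Cooper remainder constant -/
  C_W : ℝ
  /-- first-moment constant -/
  Cd : ℝ
  /-- Cooper-class resolution offset -/
  t₀ : ℕ

/-- Well-formedness of `P`: signs (`Klam ≥ 1` so that the bare vertex is covered). -/
def SplitConsts.WF (P : SplitConsts) : Prop :=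
    (1 ≤ P.Klam) ∧
    (0 ≤ P.C_W) ∧
    (0 ≤ P.Cd)

/-- **`Q` — the engine's constants** (chosen by child 3 knowing `P`; they multiply one extra power of `|U|` or the genuinely
higher-order sizes): the tree-expansion constant `CE` (BGM (2.77)'s `c` with `|U| ↦ Klam|U|`), the non-ladder cubic remainder
`CR` (E.5/E.5d), the `|U|`-slacks `c0` (initial blocks), `cE4`, `S' j`, `Bf`, `SL`, the finite-volume evaluation error
`CL β n / L`, and the volume / Matsubara thresholds `L0 β`, `M0 β L` beyond which the bounds are claimed ((E5): K3 is an
`L → ∞` statement at fixed `β`). -/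
structure EngConsts where
  /-- tree-expansion constant of (E1) -/
  CE : ℝ
  /-- non-ladder cubic remainder constant (E.5d) -/
  CR : ℝ
  /-- `|U|`-slack of the initial block data -/
  c0 : ℝ
  /-- `|U|`-slack of (E4) -/
  cE4 : ℝ
  /-- `|U|`-slacks of the two-leg sizes -/
  S' : ℕ → ℝ
  /-- higher-order tangential-floor junk: `Bf·|U|³` per scale -/
  Bf : ℝ
  /-- `|U|`-slack of the frame-Lipschitz constant -/
  SL : ℝ
  /-- finite-volume evaluation error `CL β n / L` of the localised arrays -/
  CL : ℝ → ℕ → ℝ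
  /-- volume threshold `L ≥ L0 β` -/
  L0 : ℝ → ℕ
  /-- Matsubara threshold `M ≥ M0 β L` -/
  M0 : ℝ → ℕ → ℕ

/-- Well-formedness of `Q`: signs. -/
def EngConsts.WF (Q : EngConsts) : Prop :=
    (0 ≤ Q.CE) ∧
    (0 ≤ Q.CR) ∧
    (0 ≤ Q.c0) ∧
    (0 ≤ Q.cE4) ∧
    (∀ j, 0 ≤ Q.S' j) ∧
    (0 ≤ Q.Bf) ∧
    (0 ≤ Q.SL) ∧
    (∀ β n, 0 ≤ Q.CL β n)

/-- **`R` — the renormalisation / frame constants** (chosen by child 2): mismatch `cr`, field-strength slack `cz`, and the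
multiscale smoothness constants `Gfr j` of the frame's pieces. -/
structure RenConsts where
  /-- Fermi-curve mismatch at scale `n` `≤ cr·|U|·Λ_n` -/
  cr : ℝ
  /-- `|z - 1| ≤ cz·|U|` on the shell -/
  cz : ℝ
  /-- `j`-th derivative of the `n`-th frame piece `≤ Gfr j · uPow j U · 4^{(j-2)n}` -/
  Gfr : ℕ → ℝ

/-- Well-formedness of `R`: signs. -/
def RenConsts.WF (R : RenConsts) : Prop :=
    (0 ≤ R.cr) ∧
    (0 ≤ R.cz) ∧
    (∀ j, 0 ≤ R.Gfr j)

/-! ## §2 Deterministic majorants (the envelopes of (B1) are built from these, so that the no-onset condition is a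
statement about constants, not about the instance) -/

/-- **The one-step remainder majorant** `ē_n = cloc·(Klam U)²·4^{-θ n} + CR·(Klam|U|)³·2^{-n} + CL(β,n)/L` (ENGINE-PRED §3:
ladder-localisation slack, non-ladder cubic output of the step (E.5/E.5d), finite-volume evaluation error). -/
def eremBar (G : GeoConsts) (P : SplitConsts) (Q : EngConsts) (U β : ℝ) (L n : ℕ) : ℝ :=
  G.cloc * (P.Klam * U) ^ 2 * (4 : ℝ) ^ (-(G.θ * n)) + Q.CR * (P.Klam * |U|) ^ 3 * ((2 : ℝ) ^ n)⁻¹ + Q.CL β n / L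

/-- **The attractive drive majorant** of channel `χ` at scale `n`: `a χ · U² · ζ n`. -/
def driveBar (G : GeoConsts) (U : ℝ) (χ : D4Irrep) (n : ℕ) : ℝ := G.a χ * U ^ 2 * G.ζ n

/-- **The repulsive drive majorant** at scale `n`: `aplus · (Klam U)² · ζ n`. -/
def drivePBar (G : GeoConsts) (P : SplitConsts) (U : ℝ) (n : ℕ) : ℝ := G.aplus * (P.Klam * U) ^ 2 * G.ζ n

/-- Cumulative bubble-mass majorant `B̄_n = bhi · n`. -/
def Bcum (G : GeoConsts) (n : ℕ) : ℝ := G.bhi * n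

/-- Cumulative attractive budget of channel `χ` below scale `n`: `Ē_χ(n) = Σ_{j<n} (ē_j + driveBar χ j)`. -/
def Ecum (G : GeoConsts) (P : SplitConsts) (Q : EngConsts) (U β : ℝ) (L : ℕ) (χ : D4Irrep) (n : ℕ) : ℝ :=
  ∑ j ∈ range n, (eremBar G P Q U β L j + driveBar G U χ j)

/-- Cumulative repulsive budget below scale `n`: `Ē⁺(n) = Σ_{j<n} (ē_j + drivePBar j)`. -/
def EcumP (G : GeoConsts) (P : SplitConsts) (Q : EngConsts) (U β : ℝ) (L : ℕ) (n : ℕ) : ℝ :=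
  ∑ j ∈ range n, (eremBar G P Q U β L j + drivePBar G P U j)

/-- The attractive envelope start of channel `χ`: `A₀(χ) = (abot χ + 1)·U²` (the `+1` absorbs the engine's `|U|`-slack). -/
def abot0 (G : GeoConsts) (U : ℝ) (χ : D4Irrep) : ℝ := (G.abot χ + 1) * U ^ 2

/-- The repulsive envelope start of channel `χ`: `A⁺₀(χ) = (atop χ + 1)·|U|`. -/
def atop0 (G : GeoConsts) (U : ℝ) (χ : D4Irrep) : ℝ := (G.atop χ + 1) * |U|

/-- **Two-leg increment majorants** (BGM (2.36) without `|h|`): `j`-th derivative of the scale-`n` piece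
`≤ (S j + S' j·|U|) · uPow j U · 4^{(j-2) n}` (`j = 0`: `|U|4^{-2n}`; `j = 1`: `U²4^{-n}`; `j = 2`: `U²`, no gain; `j = 3, 4`:
the sector-compatible growth `U²4^{n}`, `U²4^{2n}` of (2.42)). -/
def twoLegBar (G : GeoConsts) (Q : EngConsts) (U : ℝ) (j n : ℕ) : ℝ :=
  (G.S j + Q.S' j * |U|) * uPow j U * (4 : ℝ) ^ (((j : ℤ) - 2) * n)

/-- **Tangential-floor junk majorant** of the scale-`n` piece: `Bf·U²·4^{-θn} + Bf'·|U|³` (second order summable, orders `≥ 3`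
one per scale: `Σ_{n ≤ N} = O(U² + |U|³N) = O(U² + |U|c)` in the KL regime). -/
def bflBar (G : GeoConsts) (Q : EngConsts) (U : ℝ) (n : ℕ) : ℝ :=
  G.Bf * U ^ 2 * (4 : ℝ) ^ (-(G.θ * n)) + Q.Bf * |U| ^ 3

/-- **Frame-Lipschitz majorant** of the scale-`n` piece: `(SL + SL'|U|)·|U|·4^{-n}` (summable to `O(|U|)`: contraction). -/
def lipBar (G : GeoConsts) (Q : EngConsts) (U : ℝ) (n : ℕ) : ℝ :=
  (G.SL + Q.SL * |U|) * |U| * ((4 : ℝ) ^ n)⁻¹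

/-! ## §3 D1″ — localisation of the two-leg kernel and the renormalisation predicate (over the tree's
`SymmetricRegimeFunctionals.fermiMismatch` / `fieldStrength`; no new operator is needed) -/

section Model

variable (L M : ℕ) [NeZero L] [NeZero M]

/-- The scale-`n` shell `S_n = {k⃗ : |e_K(k⃗)| ≤ Λ_n}` of the frame band on the torus. -/
def klShell (μ : ℝ) (K : TrigPolyC4v) (n : ℕ) : Finset (TorusSite 2 L) :=
  momentumShell L (nambuXiCT L μ K) (klScale klE0 n)

/-- **The Fermi-curve mismatch of the frame `K` at scale `n`**: `max_{k⃗ ∈ S_n, σ} |Re Σ_n((ω₀, k⃗), σ)|` — the tree's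
`fermiMismatch` of the scale-`n` action on its own band (docstring there: «the renormalisation condition of the countertermed
frame is `m_Λ` small against `Λ`»). -/
def klFermiMismatch (β U μ : ℝ) (K : TrigPolyC4v) (n : ℕ) : ℝ :=
  fermiMismatch L M β (nambuXiCT L μ K) (klScale klE0 n) (klEffectiveAction L M β U μ K klE0 n)

/-- The field strength `z_n(k⃗)` of the scale-`n` action (the tree's `fieldStrength`: centred difference quotient of `Im Σ_n`
over the two lowest frequencies, spin-averaged). -/
def klFieldStrength (β U μ : ℝ) (K : TrigPolyC4v) (n : ℕ) (k : TorusSite 2 L) : ℝ :=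
  fieldStrength L M β (klEffectiveAction L M β U μ K klE0 n) k

/-- **The localised two-leg value** of the scale-`n` action at lattice momentum `k⃗`: the spin- and `±ω₀`-average of
`Re Σ_n` — `¼ Σ_σ [Re Σ_n((ω₀,k⃗),σ) + Re Σ_n((-ω₀,k⃗),σ)]` (for the symmetric model all four agree, (E0)).  It CONTAINS the
frame vertex `+K(p_k⃗)` (D1's carrier puts `𝒩_K` in the interaction slot). -/
def klLocSelfEnergyRe (β U μ : ℝ) (K : TrigPolyC4v) (n : ℕ) (k : TorusSite 2 L) : ℝ :=
  (∑ σ : Fin 2, ((klSelfEnergy L M β U μ K klE0 n (omega0 M, k) σ).re +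
      (klSelfEnergy L M β U μ K klE0 n ((omega0 M).rev, k) σ).re)) / 4

/-- **`RenormalisedAt … R K n`** — the frame is renormalised down to scale `n`: mismatch `≤ cr·|U|·Λ_n` and `|z_n - 1| ≤ cz·|U|`
on the shell `S_n`.  Hypothesis of every engine step at the higher scales; concluded for all scales at once by child 2. -/
def RenormalisedAt (β U μ : ℝ) (K : TrigPolyC4v) (R : RenConsts) (n : ℕ) : Prop :=
  klFermiMismatch L M β U μ K n ≤ R.cr * |U| * klScale klE0 n ∧
    ∀ k ∈ klShell L μ K n, |klFieldStrength L M β U μ K n k - 1| ≤ R.cz * |U|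

end Model

/-! ## §9 Bookkeeping lemmas -/

/-- `uPow 0 U = |U|`. -/
@[simp] theorem uPow_zero (U : ℝ) : uPow 0 U = |U| := by simp [uPow]

/-- `uPow (j+1) U = U²`. -/
@[simp] theorem uPow_succ (j : ℕ) (U : ℝ) : uPow (j + 1) U = U ^ 2 := by simp [uPow]

/-- `0 ≤ uPow j U`. -/
theorem uPow_nonneg (j : ℕ) (U : ℝ) : 0 ≤ uPow j U := by
  unfold uPow; split_ifs <;> positivity

/-- The cumulative budgets vanish at scale `0`. -/
@[simp] theorem Ecum_zero (G : GeoConsts) (P : SplitConsts) (Q : EngConsts) (U β : ℝ) (L : ℕ) (χ : D4Irrep) :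
    Ecum G P Q U β L χ 0 = 0 := by simp [Ecum]

/-- The cumulative repulsive budget vanishes at scale `0`. -/
@[simp] theorem EcumP_zero (G : GeoConsts) (P : SplitConsts) (Q : EngConsts) (U β : ℝ) (L : ℕ) :
    EcumP G P Q U β L 0 = 0 := by simp [EcumP]

/-- `B̄_0 = 0`. -/
@[simp] theorem Bcum_zero (G : GeoConsts) : Bcum G 0 = 0 := by simp [Bcum]

/-- One more scale of attractive budget. -/
theorem Ecum_succ (G : GeoConsts) (P : SplitConsts) (Q : EngConsts) (U β : ℝ) (L : ℕ) (χ : D4Irrep) (n : ℕ) :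
    Ecum G P Q U β L χ (n + 1) = Ecum G P Q U β L χ n + (eremBar G P Q U β L n + driveBar G U χ n) := by
  simp [Ecum, sum_range_succ]

/-- One more scale of bubble mass. -/
theorem Bcum_succ (G : GeoConsts) (n : ℕ) : Bcum G (n + 1) = Bcum G n + G.bhi := by
  simp [Bcum]; ring

end Summit.HubbardSuperconductivity.HubbardSuperconductivity.Theorems.KLRegimeSplit

end
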